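import Literature.MathematicalPhysics.QuantumFieldTheory.Balaban1983to89.Node00.LinearisedAveragingEquivariant
import Literature.MathematicalPhysics.QuantumFieldTheory.Balaban1983to89.Node00.LinearisedAveragingFlat

/-!
# NODE 00 — THE VELOCITY OF A GAUGE-SHEARED ITERATE: `d∕dt [C_{w(t)}(Ū^k(V(t)))]` = conjugated `Q_k`-velocity + SHEAR TERMS, and at the flat background
# `= Q_k(1)V̇ + (ω(c₋) − ω(c₊))` (module D4-shear of the [15] Sect. B audit of seat `pub-ymgap-dag-n07-w1`; operator-side calculus for dag-n07-e's BRIDGE-92 (4))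

Cell `pub-ymgap`, width seat `pub-ymgap-dag-n07-w1` generation 4 (DAG node N07 = [15] = [Balaban1985Variational]).  NEW leaf, THEOREMS ONLY (0 `def`), `--kind proof --supports
stmt-QuantumFields-20542` (K1⁷), count-neutral.  CONSUMED BY NAME, nothing modified: this seat's `Node00.LinearisedAveragingEquivariant` (`fieldConj` = `C_u`, `coeField_gaugeAct`),
`Node00.LinearisedAveragingAtBackground` (`dIterL` = `Q_k`, `hasDerivAt_coeField_iter_of_eventually`), `Node00.LinearisedAveragingFlat` (`hasFDerivAt_iterM_one`, `iterM_apply_one`: the flat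
background is a fixed point in the polydisc — NO guard), 35b `Node00.AveragingSmooth` (`coeField`, `iterM`, `SmallBelow`), `Node00.WilsonActionSecondVariation` (`star_coe_mul_coe_SU`), Mathlib
`HasDerivAt.mul ∕ .star ∕ hasDerivAt_pi`.

THE PRINT ∕ WHY.  dag-n07-e's LOCATED-BRIDGE-92 (cell bus l.28090, [Balaban1985Averaging] (70) p.29, (78)–(92) pp.30–32; [Balaban1985Variational] (154)–(156) p.301): the data side of (154)–(156) for
the symmetrised (0.4) averaging goes through the GAUGE-SHEARED iterate `Ũ(c) = (ū u⁻¹)(emb c₋)·Ū^k(U₁)(c)·(u ū⁻¹)(emb c₊)` — a conjugation `C_{w}` of the iterate by site unitaries that MOVE with the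
field — and the heart needs ITS linearisation «`lin Ũ = Lᵏ·Q − ∂∘(…)`»: the `Q_k`-velocity of the iterate plus the lattice gradient of the infinitesimal gauge transformation.  This file is that
product rule, for ANY differentiable families `w(t)` (gauge transformations of the output lattice) and `M(t)` (output matrix fields) ∕ `V(t)` (input fields), with no reference to which gauge
fixing produces `w` (the (88)-functional itself — BRIDGE-92's definer item — is NOT typed here).

CONTENTS (`M = M_N(ℂ)`; level `j`; `w : ℝ → GaugeTransf P j (SU N)` with site derivatives `ω x = d∕dt ↑(w t x)|_{t₀}`).
* §1 ★ `hasDerivAt_fieldConj_family` — the product rule: `d∕dt C_{w(t)}(M(t)) = ω(b₋)·M·w(b₊)⋆ + w(b₋)·Ṁ·w(b₊)⋆ + w(b₋)·M·ω(b₊)⋆` (bond-wise, at any `t₀`); `star_siteDeriv_add_self_of_one`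
  (through `w(t₀) = 1`: `ω(x)⋆ + ω(x) = 0` — the velocity is skew, from `w⋆w = 1`); ★ `hasDerivAt_fieldConj_family_of_one` (through `w(t₀) = 1`: `d∕dt C_{w(t)}(M(t)) = Ṁ + (ω(b₋)·M − M·ω(b₊))`).
* §2 ★★ `hasDerivAt_fieldConj_iterM_family` (matrix level, any `V(t)` at which `iterM k` is differentiable: `d∕dt C_{w(t)}(iterM k (V t)) =` §1 with `Ṁ = Q_k(V(t₀))V̇`), ★★★
  `hasDerivAt_fieldConj_iterM_family_flat` — **AT THE FLAT BACKGROUND (`V(0) = 1`, `w(0) = 1`, NO guard): `d∕dt C_{w(t)}(iterM k (V t))|₀ (c) = (Q_k(1)V̇)(c) + (ω(c₋) − ω(c₊))`** — the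
  operator `Q_k(1)` of `Node00.LinearisedAveragingFlat` (= the `linAvg` recursion on skew fields) SHEARED by minus the lattice gradient of `ω` along `c`.
* §3 on `SU(N)` data (the TRUE averaging, guard below `k` eventually along the family): ★★ `hasDerivAt_coeField_gaugeAct_iter_family` (`d∕dt ↑((Ū^k(Γ t))^{w t})|₀ =` §1 with
  `Ṁ = Q_k(↑Γ 0)Γ̇`, via `coeField_gaugeAct` + `hasDerivAt_coeField_iter_of_eventually`).

ADJACENT, BY NAME (dag-lead DEDUP l.29496; plan g83 WORDS-2 road R0′): n07-w7's `Summits/…/Theorems/BalabanUVNodesN07FlatHOfCoarseGradient` (print's `H` applied to a coarse pure gauge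
`∂_cλ`: on road R0′ the shear `ω(c₋) − ω(c₊) = −(∂_c ω)` produced HERE is absorbed at linear order by `H(∂_cλ) = ∂μ` THERE); dag-n07-e's `Node00.ShearedAveragingFlat` (p607232: `shearRIter`,
`shearedAvgIter` — the group-level (88)-functional whose linearisation «R4 file 2» runs on `hasDerivAt_fieldConj_iterM_family_flat` with `w t := (S_j(U₁ t))⁻¹`).

HONEST FRAMING: elementary calculus (product rule) about the tree's own letters; NO estimate of [15]∕[3]; the (88)-functional ∕ the gauge fixing `u(U₁)` ∕ the (154)–(156) data side are NOT here; N07 NOT discharged;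
counts unmoved (typed 28∕28 · discharged 5∕27); one finite 𝕋⁴ programme at fixed ε — NOT continuum ∕ ℝ⁴ ∕ OS ∕ mass gap ∕ Clay (R4 closes the conditional finite-𝕋⁴ rung `BalabanLadder.UV` only).  No `sorry`,
no `def`, no `instance`, no `notation`.
-/

noncomputable section

namespace Literature.MathematicalPhysics.QuantumFieldTheory.Balaban1983to89.Node00

open Filter Topology
open T4Continuum BlockAveraging B15DeterminingSets
open ExpMeanLog (expMeanLogSU)
open scoped Matrix.Norms.L2Operator

/-! ## §1  The product rule for a moving conjugation -/

section ProductRule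

variable {P : Params} {j : ℕ} {N : ℕ}

/-- ★ **THE PRODUCT RULE FOR A MOVING CONJUGATION**: if `t ↦ ↑(w t x)` has derivative `ω x` at `t₀` for every site and `t ↦ M t` has derivative `Ṁ` at `t₀`, then
`t ↦ C_{w(t)}(M(t))` has derivative `b ↦ ω(b₋)·M(t₀)(b)·w(t₀)(b₊)⋆ + w(t₀)(b₋)·Ṁ(b)·w(t₀)(b₊)⋆ + w(t₀)(b₋)·M(t₀)(b)·ω(b₊)⋆`. [cite: Balaban1985Averaging, (8) p.18, (70) p.29] -/
theorem hasDerivAt_fieldConj_family {w : ℝ → GaugeTransf P j (SU N)} {M : ℝ → PBond P j → Matrix (Fin N) (Fin N) ℂ}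
    {ω : Site P j → Matrix (Fin N) (Fin N) ℂ} {Mdot : PBond P j → Matrix (Fin N) (Fin N) ℂ} {t₀ : ℝ}
    (hw : ∀ x : Site P j, HasDerivAt (fun t : ℝ => ((w t x : SU N) : Matrix (Fin N) (Fin N) ℂ)) (ω x) t₀) (hM : HasDerivAt M Mdot t₀) :
    HasDerivAt (fun t : ℝ => fieldConj (w t) (M t))
      (fun b => ω b.src * M t₀ b * star ((w t₀ b.tgt : SU N) : Matrix (Fin N) (Fin N) ℂ) +
        ((w t₀ b.src : SU N) : Matrix (Fin N) (Fin N) ℂ) * Mdot b * star ((w t₀ b.tgt : SU N) : Matrix (Fin N) (Fin N) ℂ) +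
        ((w t₀ b.src : SU N) : Matrix (Fin N) (Fin N) ℂ) * M t₀ b * star (ω b.tgt)) t₀ := by
  refine hasDerivAt_pi.2 fun b => ?_
  have hb : HasDerivAt (fun t : ℝ => M t b) (Mdot b) t₀ := (hasDerivAt_pi.1 hM) b
  exact (((hw b.src).mul hb).mul (hw b.tgt).star).congr_deriv (by simp only [Pi.mul_apply]; noncomm_ring)

/-- **THE VELOCITY OF A FAMILY OF UNITARIES THROUGH `1` IS SKEW**: if `t ↦ ↑(w t x)` has derivative `ω x` at `t₀` and `w t₀ x = 1`, then `ω(x)⋆ + ω(x) = 0` (differentiate `w⋆w = 1`).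
[cite: Balaban1985BackgroundPropagators, (3.1)-(3.2) p.390 (bookkeeping)] -/
theorem star_siteDeriv_add_self_of_one {w : ℝ → GaugeTransf P j (SU N)} {ω : Site P j → Matrix (Fin N) (Fin N) ℂ} {t₀ : ℝ} {x : Site P j}
    (hw : HasDerivAt (fun t : ℝ => ((w t x : SU N) : Matrix (Fin N) (Fin N) ℂ)) (ω x) t₀) (h1 : w t₀ x = 1) : star (ω x) + ω x = 0 := by
  have hprod : HasDerivAt (fun t : ℝ => star ((w t x : SU N) : Matrix (Fin N) (Fin N) ℂ) * ((w t x : SU N) : Matrix (Fin N) (Fin N) ℂ))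
      (star (ω x) * ((w t₀ x : SU N) : Matrix (Fin N) (Fin N) ℂ) + star ((w t₀ x : SU N) : Matrix (Fin N) (Fin N) ℂ) * ω x) t₀ := hw.star.mul hw
  have hconst : (fun t : ℝ => star ((w t x : SU N) : Matrix (Fin N) (Fin N) ℂ) * ((w t x : SU N) : Matrix (Fin N) (Fin N) ℂ)) = fun _ => 1 :=
    funext fun t => star_coe_mul_coe_SU (w t x)
  rw [hconst] at hprod
  have h0 := (hasDerivAt_const t₀ (1 : Matrix (Fin N) (Fin N) ℂ)).unique hprod
  rw [h1] at h0
  simpa using h0.symm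

/-- Through `w(t₀) = 1` the skewness reads `ω(x)⋆ = −ω(x)`. [cite: Balaban1985BackgroundPropagators, (3.1)-(3.2) p.390 (bookkeeping)] -/
theorem star_siteDeriv_of_one {w : ℝ → GaugeTransf P j (SU N)} {ω : Site P j → Matrix (Fin N) (Fin N) ℂ} {t₀ : ℝ} {x : Site P j}
    (hw : HasDerivAt (fun t : ℝ => ((w t x : SU N) : Matrix (Fin N) (Fin N) ℂ)) (ω x) t₀) (h1 : w t₀ x = 1) : star (ω x) = -ω x :=
  eq_neg_of_add_eq_zero_left (star_siteDeriv_add_self_of_one hw h1)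

/-- ★ **THROUGH THE IDENTITY TRANSFORMATION**: if moreover `w t₀ = 1`, then `d∕dt C_{w(t)}(M(t))|_{t₀} (b) = Ṁ(b) + (ω(b₋)·M(t₀)(b) − M(t₀)(b)·ω(b₊))` — the velocity of `M` plus the
INFINITESIMAL GAUGE SHEAR. [cite: Balaban1985Averaging, (8) p.18, (70) p.29; Balaban1985BackgroundPropagators, (3.29) p.395] -/
theorem hasDerivAt_fieldConj_family_of_one {w : ℝ → GaugeTransf P j (SU N)} {M : ℝ → PBond P j → Matrix (Fin N) (Fin N) ℂ}
    {ω : Site P j → Matrix (Fin N) (Fin N) ℂ} {Mdot : PBond P j → Matrix (Fin N) (Fin N) ℂ} {t₀ : ℝ}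
    (hw : ∀ x : Site P j, HasDerivAt (fun t : ℝ => ((w t x : SU N) : Matrix (Fin N) (Fin N) ℂ)) (ω x) t₀) (h1 : ∀ x, w t₀ x = 1) (hM : HasDerivAt M Mdot t₀) :
    HasDerivAt (fun t : ℝ => fieldConj (w t) (M t)) (fun b => Mdot b + (ω b.src * M t₀ b - M t₀ b * ω b.tgt)) t₀ := by
  refine (hasDerivAt_fieldConj_family hw hM).congr_deriv (funext fun b => ?_)
  rw [h1 b.src, h1 b.tgt, star_siteDeriv_of_one (hw b.tgt) (h1 b.tgt)]
  simp only [OneMemClass.coe_one, star_one, mul_one, one_mul, mul_neg]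
  abel

end ProductRule

/-! ## §2  The sheared ITERATE on the matrix level; the flat background -/

section Iterate

variable {P : Params} {N : ℕ}

/-- ★★ **THE VELOCITY OF A GAUGE-SHEARED ITERATE (matrix level)**: if `iterM k` is differentiable at `V t₀` (e.g. under 35b's guard, or at the flat background), `V` has velocity `Y` at
`t₀`, and the output-lattice unitaries `w(t)` have site velocities `ω`, then `d∕dt C_{w(t)}(iterM k (V t))|_{t₀}` is §1's product rule with `Ṁ = Q_k(V t₀) Y`.
[cite: Balaban1985Variational, (44) p.285; Balaban1985Averaging, (70) p.29] -/
theorem hasDerivAt_fieldConj_iterM_family {k : ℕ} {w : ℝ → GaugeTransf P k (SU N)} {V : ℝ → PBond P 0 → Matrix (Fin N) (Fin N) ℂ}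
    {ω : Site P k → Matrix (Fin N) (Fin N) ℂ} {Y : PBond P 0 → Matrix (Fin N) (Fin N) ℂ} {t₀ : ℝ}
    (hw : ∀ x : Site P k, HasDerivAt (fun t : ℝ => ((w t x : SU N) : Matrix (Fin N) (Fin N) ℂ)) (ω x) t₀)
    (hd : DifferentiableAt ℝ (iterM k : (PBond P 0 → Matrix (Fin N) (Fin N) ℂ) → PBond P k → Matrix (Fin N) (Fin N) ℂ) (V t₀)) (hV : HasDerivAt V Y t₀) :
    HasDerivAt (fun t : ℝ => fieldConj (w t) (iterM k (V t)))
      (fun c => ω c.src * iterM k (V t₀) c * star ((w t₀ c.tgt : SU N) : Matrix (Fin N) (Fin N) ℂ) +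
        ((w t₀ c.src : SU N) : Matrix (Fin N) (Fin N) ℂ) * dIterL k (V t₀) Y c * star ((w t₀ c.tgt : SU N) : Matrix (Fin N) (Fin N) ℂ) +
        ((w t₀ c.src : SU N) : Matrix (Fin N) (Fin N) ℂ) * iterM k (V t₀) c * star (ω c.tgt)) t₀ :=
  hasDerivAt_fieldConj_family hw (hd.hasFDerivAt.comp_hasDerivAt t₀ hV)

/-- ★★★ **AT THE FLAT BACKGROUND** (`V t₀ = 1`, `w t₀ = 1`; NO guard — the trivial field is a fixed point in the polydisc, `hasFDerivAt_iterM_one`):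
`d∕dt C_{w(t)}(iterM k (V t))|_{t₀} (c) = (Q_k(1) Y)(c) + (ω(c₋) − ω(c₊))` — the flat linearised averaging SHEARED by minus the lattice gradient of the infinitesimal gauge transformation along `c`
(the shape «`lin Ũ = Q − ∂(…)`» of BRIDGE-92 (4)). [cite: Balaban1985Variational, (44),(47) p.285, (154)-(156) p.301; Balaban1985Averaging, (70) p.29, (92) p.32] -/
theorem hasDerivAt_fieldConj_iterM_family_flat {k : ℕ} {w : ℝ → GaugeTransf P k (SU N)} {V : ℝ → PBond P 0 → Matrix (Fin N) (Fin N) ℂ}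
    {ω : Site P k → Matrix (Fin N) (Fin N) ℂ} {Y : PBond P 0 → Matrix (Fin N) (Fin N) ℂ} {t₀ : ℝ}
    (hw : ∀ x : Site P k, HasDerivAt (fun t : ℝ => ((w t x : SU N) : Matrix (Fin N) (Fin N) ℂ)) (ω x) t₀) (h1 : ∀ x, w t₀ x = 1)
    (hV0 : V t₀ = 1) (hV : HasDerivAt V Y t₀) :
    HasDerivAt (fun t : ℝ => fieldConj (w t) (iterM k (V t))) (fun c => dIterL k 1 Y c + (ω c.src - ω c.tgt)) t₀ := by
  have hd : HasDerivAt (fun t : ℝ => iterM k (V t)) (dIterL k 1 Y) t₀ := by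
    have h := (hasFDerivAt_iterM_one (P := P) (N := N) k)
    rw [← hV0] at h
    have hc := h.comp_hasDerivAt t₀ hV
    rwa [hV0] at hc
  refine (hasDerivAt_fieldConj_family_of_one hw h1 hd).congr_deriv (funext fun c => ?_)
  rw [hV0, iterM_apply_one]
  simp only [Pi.one_apply, mul_one, one_mul]

end Iterate

/-! ## §3  On `SU(N)` data: the sheared TRUE iterate `(Ū^k(Γ t))^{w t}` -/

section True

variable {P : Params} {N : ℕ} [NeZero N]

/-- ★★ **THE VELOCITY OF THE GAUGE-SHEARED TRUE ITERATE**: along a family `Γ` of `SU(N)` configurations with matrix velocity `Y` at `0` and 35b's guard below `k` eventually along `Γ`, and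
output-lattice gauge transformations `w(t)` with site velocities `ω`, `t ↦ ↑((Ū^k(Γ t))^{w t})` has derivative §1's product rule with `M(0) = ↑Ū^k(Γ 0)` and `Ṁ = Q_k(↑Γ 0) Y`
(`coeField_gaugeAct` + `hasDerivAt_coeField_iter_of_eventually`). [cite: Balaban1985Averaging, (11) p.19, (70) p.29; Balaban1985Variational, (44) p.285] -/
theorem hasDerivAt_coeField_gaugeAct_iter_family {k : ℕ} {w : ℝ → GaugeTransf P k (SU N)} {Γ : ℝ → GaugeField P 0 (SU N)}
    {ω : Site P k → Matrix (Fin N) (Fin N) ℂ} {Y : PBond P 0 → Matrix (Fin N) (Fin N) ℂ}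
    (hw : ∀ x : Site P k, HasDerivAt (fun t : ℝ => ((w t x : SU N) : Matrix (Fin N) (Fin N) ℂ)) (ω x) 0)
    (hΓ : HasDerivAt (fun t => coeField (Γ t)) Y 0)
    (hev : ∀ᶠ t in 𝓝 (0 : ℝ), SmallBelow (fun j => blockAvg (P := P) (j := j) expMeanLogSU) k (Γ t)) :
    HasDerivAt (fun t : ℝ => coeField (GaugeField.gaugeAct (w t) (Averaging.iter (fun j => blockAvg (P := P) (j := j) expMeanLogSU) k (Γ t))))
      (fun c => ω c.src * ((Averaging.iter (fun j => blockAvg (P := P) (j := j) expMeanLogSU) k (Γ 0) c : SU N) : Matrix (Fin N) (Fin N) ℂ) *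
          star ((w 0 c.tgt : SU N) : Matrix (Fin N) (Fin N) ℂ) +
        ((w 0 c.src : SU N) : Matrix (Fin N) (Fin N) ℂ) * dIterL k (coeField (Γ 0)) Y c * star ((w 0 c.tgt : SU N) : Matrix (Fin N) (Fin N) ℂ) +
        ((w 0 c.src : SU N) : Matrix (Fin N) (Fin N) ℂ) * ((Averaging.iter (fun j => blockAvg (P := P) (j := j) expMeanLogSU) k (Γ 0) c : SU N) : Matrix (Fin N) (Fin N) ℂ) *
          star (ω c.tgt)) 0 := by
  have hM := hasDerivAt_coeField_iter_of_eventually hΓ hev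
  have h := hasDerivAt_fieldConj_family (t₀ := 0) hw hM
  simp only [coeField_apply] at h
  refine (h.congr_of_eventuallyEq (Eventually.of_forall fun t => ?_))
  exact coeField_gaugeAct (w t) _

/-- ★★ **THROUGH THE IDENTITY TRANSFORMATION** (`w 0 = 1`): `d∕dt ↑((Ū^k(Γ t))^{w t})|₀ (c) = (Q_k(↑Γ 0) Y)(c) + (ω(c₋)·↑Ū^k(Γ 0)(c) − ↑Ū^k(Γ 0)(c)·ω(c₊))`.
[cite: Balaban1985Averaging, (11) p.19, (70) p.29; Balaban1985Variational, (44) p.285; Balaban1985BackgroundPropagators, (3.29) p.395] -/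
theorem hasDerivAt_coeField_gaugeAct_iter_family_of_one {k : ℕ} {w : ℝ → GaugeTransf P k (SU N)} {Γ : ℝ → GaugeField P 0 (SU N)}
    {ω : Site P k → Matrix (Fin N) (Fin N) ℂ} {Y : PBond P 0 → Matrix (Fin N) (Fin N) ℂ}
    (hw : ∀ x : Site P k, HasDerivAt (fun t : ℝ => ((w t x : SU N) : Matrix (Fin N) (Fin N) ℂ)) (ω x) 0) (h1 : ∀ x, w 0 x = 1)
    (hΓ : HasDerivAt (fun t => coeField (Γ t)) Y 0)
    (hev : ∀ᶠ t in 𝓝 (0 : ℝ), SmallBelow (fun j => blockAvg (P := P) (j := j) expMeanLogSU) k (Γ t)) :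
    HasDerivAt (fun t : ℝ => coeField (GaugeField.gaugeAct (w t) (Averaging.iter (fun j => blockAvg (P := P) (j := j) expMeanLogSU) k (Γ t))))
      (fun c => dIterL k (coeField (Γ 0)) Y c +
        (ω c.src * ((Averaging.iter (fun j => blockAvg (P := P) (j := j) expMeanLogSU) k (Γ 0) c : SU N) : Matrix (Fin N) (Fin N) ℂ) -
          ((Averaging.iter (fun j => blockAvg (P := P) (j := j) expMeanLogSU) k (Γ 0) c : SU N) : Matrix (Fin N) (Fin N) ℂ) * ω c.tgt)) 0 := by
  have hM := hasDerivAt_coeField_iter_of_eventually hΓ hev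
  have h := hasDerivAt_fieldConj_family_of_one (t₀ := 0) hw h1 hM
  simp only [coeField_apply] at h
  refine (h.congr_of_eventuallyEq (Eventually.of_forall fun t => ?_))
  exact coeField_gaugeAct (w t) _

end True

end Literature.MathematicalPhysics.QuantumFieldTheory.Balaban1983to89.Node00

end
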